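import Summits.AtomisticToContinuum.BoseEinsteinCondensation.Theorems.BECThomsonPrincipleGDTransferSeededTransportClosed

/-!
# Route `BECThomsonPrinciple`, crux `GDTransfer` (stmt-AtomisticToContinuum-9482), line `seeded-continuity`:
# fifth Defs file — the INTEGRABLE re-cut of the singular rest (lead c3, skeleton v7)

`Defs` file (D-0016) continuing `…SeededDefs` (p137609), `…SeededWitnessDefs` (p139431), `…SeededRoughDefs` (p147682)
and `…SeededTransportDefs` (p153539).  Skeleton v6.1 (all five measurable-transport stubs landed, composition
`…SeededTransportClosed` p156802) leaves two registered stubs: the SEED `stub_noBalancedCat` and `stub_singularRest`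
(ESSENTIALLY UNBOUNDED admissible profiles).  Skeleton v7 re-cuts the latter once more, at integrability: the soft
class of the connectedness assembly is widened from (essentially) bounded measurable profiles to profiles that are
FINITE on `[0, ∞)` with SQUARE-INTEGRABLE radial lift (integrable singular cores such as `r⁻¹𝟙[r ≤ R]`; no hard
core; with finite range the lift is then in `L^{3/2}` and `L¹`), essentially such profiles being reduced to them by
the landed null-modification invariance `stub_roughNull`.
The three places where v6 used boundedness become:

* `PairPotentialBoundInt` (D'): uniformly supported profiles with small `L^{3/2}` lift have small interaction energy
  on kinetic-bounded periodic states — the v6 device was already proved through `‖w^per‖_{L^{3/2}(cell)}`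
  (`PairBound.lintegral_interaction_le` over `torusSobolev_weight_bound`, p155726/p155370), so only the passage
  `lift ∈ L^{3/2}` ⇒ `‖w^per(· − y)‖_{L^{3/2}(cell)}` small (finitely many images) is new;
* `DilationL32` (E'): `L^{3/2}`-continuity of dilations as a two-sided sandwich (v6: `L¹`, `stub_dilationL1` p155496);
* `NearMinPhaseInt`: finiteness of `E₀` and `L²`-closeness of near-minimisers up to a phase at fixed `(N, L)` for
  finite-range profiles with INTEGRABLE lift — the Ky Fan gap from `PeriodicGroundStateNondegenerateIntegrable_holds`
  (Faris–Simon on the maximal form) instead of `PeriodicGroundStateNondegenerate_holds` (bounded periodisation), the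
  form-domain dictionary needing only `W ∈ L¹(cell^N)` (v6/v4: `seeded_nearMinimisers_phase_close`, bounded);
* `stub_localConstancyInt`: local constancy of the law in the side for the integrable class, from the three above and
  `CountLaw` (c1's proof; the `ScaledClose.*` helpers of p155191 assemble (D')+(E'));
* `stub_bandEmptinessInt`: the plain-pair dichotomy re-run with pair weights in `L²_loc(cell^N)` instead of `L^∞`
  (second twin round over the `_bdd` files p155428 p155772 p156106 p156362 p156581; squared pair weights integrate
  against continuous states);
* `stub_hardCoreRest` [crux-sized, open]: profiles NOT a.e. equal to an admissible square-integrable one — hard cores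
  on a set of positive measure, non-`L²` soft cores — given GD, the seed and periodic BEC for the new class.

Objects: `IsSqIntegrableProfile`, `IsEssSqIntegrableProfile`; statements `PairPotentialBoundInt`, `DilationL32`,
`NearMinPhaseInt` (the device statements stay at the natural exponents 3/2 and 1); registered signatures `Sig.stub_bandEmptinessInt`, `Sig.stub_pairPotentialBoundInt`,
`Sig.stub_dilationL32`, `Sig.stub_nearMinPhaseInt`, `Sig.stub_localConstancyInt`, `Sig.stub_hardCoreRest`; glue
`GDTransfer_of_integrable` (sorry-free over the landed `stub_countLaw`, `stub_freeCorner`, `stub_ivtGlue`,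
`stub_roughNull`); sanity `hardCoreRest_of_gdTransfer`, `isSqIntegrableProfile_of_isBoundedProfile` and
`singularRest_of_integrable` (v7 refines v6), `lintegral_rpow_le_of_sq` / `lintegral_le_of_sq` (L² ⇒ L^{3/2}, L¹ on
finite range), `coulombCore_admissible_finite`.
Nothing open is asserted: every `def … : Prop` is consumed only as the type of a stub theorem or as a hypothesis.

References: LSSY2005 §1.2 (1.16), Ch. 2 (2.1); ReedSimonIV1978 Thm XIII.1, §XIII.12 (nondegenerate ground states,
Faris–Simon); LiebLoss2001 Thm 8.3 (Sobolev); Fournais2020 (1.1).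
-/

noncomputable section

open MeasureTheory Filter
open scoped ENNReal NNReal

namespace Summit.AtomisticToContinuum.BoseEinsteinCondensation.Cruxes.GDTransfer.Seeded

open Literature.MathematicalPhysics.QuantumManyBody.BoseGas
open Literature.Barriers.AtomisticToContinuum.BoseGas (scaledPotential)
open Summit.AtomisticToContinuum.BoseEinsteinCondensation.Theses.BECThomsonPrinciple
open Summit.AtomisticToContinuum.BoseEinsteinCondensation.Cruxes.GDTransfer.DysonDressedWitness
  (PeriodicBECFor gdTransfer_iff)

/-! ## §0 Vocabulary -/

/-- SQUARE-INTEGRABLE profile (no hard core; integrable singular cores such as `r⁻¹𝟙[r ≤ R]` allowed): finite on every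
radius `r ≥ 0` and with radial lift `x ↦ v ‖x‖` in `L²(ℝ³)`.  With finite range this puts the lift in `L^{3/2}(ℝ³)` (the
Sobolev-critical class of the transport device) and in `L¹(ℝ³)` (the integrable Ky Fan gap), see
`lintegral_rpow_le_of_sq` / `lintegral_le_of_sq`; the square is what the plain-pair chain needs for the squared pair
weights against continuous states.  Bounded finite-range measurable profiles are in it
(`isSqIntegrableProfile_of_isBoundedProfile`). -/
def IsSqIntegrableProfile (v : ℝ → ℝ≥0∞) : Prop :=
  (∀ r, 0 ≤ r → v r ≠ ⊤) ∧ (∫⁻ x : Space, v ‖x‖ ^ 2) ≠ ⊤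

/-- ESSENTIALLY square-integrable profile: a.e. equal (as a radial lift on `ℝ³`) to an admissible square-integrable
profile (so a hard core on a Lebesgue-null set of `ℝ³` is allowed; hard cores on positive measure and non-`L²` cores
are not). -/
def IsEssSqIntegrableProfile (v : ℝ → ℝ≥0∞) : Prop :=
  ∃ w : ℝ → ℝ≥0∞, IsRepulsiveFiniteRange w ∧ IsSqIntegrableProfile w ∧ ∀ᵐ x : Space, v ‖x‖ = w ‖x‖

/-! ## §1 The statements of the integrable transport device -/

/-- (D') **Pair-potential bound on kinetic-bounded states, `L^{3/2}` form.**  At fixed `N = m + 1`, side `L > 0`,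
support radius `R`, kinetic budget `K < ∞` and `ε > 0` there is `η > 0` such that every measurable radial profile `w`
vanishing beyond `R` with `∫_{ℝ³} w(|x|)^{3/2} dx ≤ η` has interaction energy `≤ ε` on every periodic trial state of
kinetic energy `≤ K`. (Strengthens v6's `PairPotentialBound`; same proof: `PairBound.lintegral_interaction_le`.) -/
def PairPotentialBoundInt : Prop :=
  ∀ (m : ℕ) (L : ℝ), 0 < L → ∀ (R : ℝ) (K : ℝ≥0∞), K ≠ ⊤ → ∀ ε : ℝ, 0 < ε →
    ∃ η : ℝ, 0 < η ∧ ∀ w : ℝ → ℝ≥0∞, Measurable w → (∀ r, R < r → w r = 0) →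
      (∫⁻ x : Space, w ‖x‖ ^ ((3 : ℝ) / 2)) ≤ ENNReal.ofReal η →
      ∀ Φ : PeriodicTrialState (m + 1) L,
        (∫⁻ X in cellN (m + 1) L, kineticDensity Φ.ψ X) ≤ K →
        (∫⁻ X in cellN (m + 1) L, periodicInteraction w L X * (‖Φ.ψ X‖₊ : ℝ≥0∞) ^ 2) ≤
          ENNReal.ofReal ε

/-- (E') **`L^{3/2}`-continuity of dilations, as a two-sided sandwich.**  For a measurable profile `u` finite on
`[0, ∞)`, of range `R₀`, with lift in `L^{3/2}(ℝ³)`, and `η > 0`, there is `ϑ > 0` such that for `|b − 1| < ϑ` some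
measurable `w` vanishing beyond `2·max R₀ 0` with `∫_{ℝ³} w(|x|)^{3/2} dx ≤ η` sandwiches the scaled profile both
ways (`w = |b⁻²u(·/b) − u|` on `[0, ∞)`; continuity of dilations in `L^{3/2}(ℝ³)` via a `C_c` approximant). -/
def DilationL32 : Prop :=
  ∀ u : ℝ → ℝ≥0∞, Measurable u → (∀ r, 0 ≤ r → u r ≠ ⊤) →
    (∫⁻ x : Space, u ‖x‖ ^ ((3 : ℝ) / 2)) ≠ ⊤ →
    ∀ R₀ : ℝ, (∀ r, R₀ < r → u r = 0) → ∀ η : ℝ, 0 < η →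
    ∃ ϑ : ℝ, 0 < ϑ ∧ ∀ b : ℝ, |b - 1| < ϑ →
      ∃ w : ℝ → ℝ≥0∞, Measurable w ∧ (∀ r, 2 * max R₀ 0 < r → w r = 0) ∧
        (∫⁻ x : Space, w ‖x‖ ^ ((3 : ℝ) / 2)) ≤ ENNReal.ofReal η ∧
        (∀ x : Space, scaledPotential u b ‖x‖ ≤ u ‖x‖ + w ‖x‖) ∧
        (∀ x : Space, u ‖x‖ ≤ scaledPotential u b ‖x‖ + w ‖x‖)

/-- **Near-minimiser phase stability at fixed `(N, L)` for finite-range profiles with integrable lift**: the periodic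
ground-state energy is finite, and for every `η > 0` some slack `δ > 0` makes any two `δ`-near-minimisers `L²(cell^N)`-close
up to a phase (Ky Fan gap `2E₀ < kyFanTwo` from `PeriodicGroundStateNondegenerateIntegrable_holds`; two-sided phase
alignment in the form-domain dictionary, which needs only `W ∈ L¹(cell^N)`). v4's `seeded_nearMinimisers_phase_close`
is the bounded case. -/
def NearMinPhaseInt : Prop :=
  ∀ u : ℝ → ℝ≥0∞, Measurable u → ∀ R₀ : ℝ, (∀ r, R₀ < r → u r = 0) → (∫⁻ x : Space, u ‖x‖) ≠ ⊤ →
    ∀ (n : ℕ) (L : ℝ), 0 < L →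
    periodicGroundStateEnergy u (n + 1) L ≠ ⊤ ∧
    ∀ η : ℝ, 0 < η → ∃ δ : ℝ≥0∞, 0 < δ ∧ ∀ Ψ Φ : PeriodicTrialState (n + 1) L,
      periodicEnergy u Ψ ≤ periodicGroundStateEnergy u (n + 1) L + δ →
      periodicEnergy u Φ ≤ periodicGroundStateEnergy u (n + 1) L + δ →
      ∃ c : ℂ, ‖c‖ = 1 ∧
        ∫⁻ X in cellN (n + 1) L, (‖Ψ.ψ X - c * Φ.ψ X‖₊ : ℝ≥0∞) ^ 2 ≤ ENNReal.ofReal (η ^ 2)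

/-! ## §2 Registered stub signatures (skeleton v7) -/

/-- Registered signature of `stub_bandEmptinessInt` [L; second twin round of the plain-pair dichotomy: pair weights in
`L²_loc(cell^N)` (finite-valued, square-integrable lift) instead of `L^∞` — boundedness entered the `_bdd` files only
as integrability / Fubini bookkeeping against continuous `C¹` states (also of squared weights) and as the a-priori
finiteness of forms; the cost constant is `8(‖v‖₁ + √‖v‖₁) + 1`]. -/
def Sig.stub_bandEmptinessInt : Prop :=
  GaussianDominationCan → ∀ v : ℝ → ℝ≥0∞, IsRepulsiveFiniteRange v → IsSqIntegrableProfile v → BandEmptiness v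

/-- Registered signature of `stub_pairPotentialBoundInt` [S–M over the landed `PairBound.lintegral_interaction_le` +
`torusSobolev_weight_bound`: only `(Σ_n a_n)^{3/2} ≤ C_img^{1/2} Σ_n a_n^{3/2}` and the tiling of `w^{3/2}` are new]. -/
def Sig.stub_pairPotentialBoundInt : Prop :=
  PairPotentialBoundInt

/-- Registered signature of `stub_dilationL32` [M; `stub_dilationL1`'s proof with exponent `3/2`
(`Memℒp.exists_hasCompactSupport_eLpNorm_sub_le`, change of variables `x ↦ x/b`)]. -/
def Sig.stub_dilationL32 : Prop :=
  DilationL32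

/-- Registered signature of `stub_nearMinPhaseInt` [M; `seeded_nearMinimisers_phase_close` /
`periodicGroundStateEnergy_ne_top_of_bounded` with `hW : ∫_{cell^N} W < ∞` from the integrable lift
(`lintegral_cell_periodizedPotential_sub`) and the gap from `PeriodicGroundStateNondegenerateIntegrable_holds`]. -/
def Sig.stub_nearMinPhaseInt : Prop :=
  NearMinPhaseInt

/-- Registered signature of `stub_localConstancyInt` [M; c1's `stub_localConstancy` / c3's `stub_localConstancyBdd`
for the square-integrable class: law stability from `NearMinPhaseInt` + `CountLaw` (2) (as `lawMass_le_of_nearMinimisers`),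
transport from (D')+(E') assembled with the landed `ScaledClose.*` helpers, kinetic a-priori bounds as in p155201;
the `L^{3/2}` / `L¹` hypotheses of the three inputs from `lintegral_rpow_le_of_sq` / `lintegral_le_of_sq`]. -/
def Sig.stub_localConstancyInt : Prop :=
  NearMinPhaseInt → PairPotentialBoundInt → DilationL32 → CountLaw →
    ∀ v : ℝ → ℝ≥0∞, IsRepulsiveFiniteRange v → IsSqIntegrableProfile v → LocalConstancy v

/-- Registered signature of `stub_hardCoreRest` [crux-sized; profiles NOT a.e. equal to an admissible integrable profile
— hard cores on a set of positive measure (plain witnesses have `⊤` energy, GD's chord is silent there; fixed-volume gap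
⇐ LemmaGConnected; side transport ⇐ Mosco) and non-integrable soft cores — given GD, the seed and periodic BEC for the
integrable class; the hard ⇐ soft comparison problem (route BECHardSphereComparison) / torus `ScatteringLengthTransfer`
(stmt-9048) / `PeriodicBEC` (stmt-0826) at the rough `v`; implied by the crux (`hardCoreRest_of_gdTransfer`)]. -/
def Sig.stub_hardCoreRest : Prop :=
  GaussianDominationCan → NoBalancedCat →
    (∀ w : ℝ → ℝ≥0∞, IsRepulsiveFiniteRange w → IsSqIntegrableProfile w → PeriodicBECFor w) →
    ∀ v : ℝ → ℝ≥0∞, IsRepulsiveFiniteRange v → ¬ IsEssSqIntegrableProfile v → PeriodicBECFor v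

/-! ## §3 Composition (sorry-free): the seven v7 statements give the crux BY NAME -/

/-- **The line (skeleton v7) concludes the crux BY NAME.**  Integrable profiles through the connectedness assembly
(count law, seed, band emptiness from GD, free corner, local constancy by the integrable transport); essentially
integrable profiles through the landed null-modification invariance `stub_roughNull`; the rest through
`stub_hardCoreRest` fed with that conclusion. -/
theorem GDTransfer_of_integrable : Summit.AtomisticToContinuum.BoseEinsteinCondensation.Cruxes.GDTransfer.Seeded.Sig.stub_noBalancedCat → Summit.AtomisticToContinuum.BoseEinsteinCondensation.Cruxes.GDTransfer.Seeded.Sig.stub_bandEmptinessInt → Summit.AtomisticToContinuum.BoseEinsteinCondensation.Cruxes.GDTransfer.Seeded.Sig.stub_pairPotentialBoundInt → Summit.AtomisticToContinuum.BoseEinsteinCondensation.Cruxes.GDTransfer.Seeded.Sig.stub_dilationL32 → Summit.AtomisticToContinuum.BoseEinsteinCondensation.Cruxes.GDTransfer.Seeded.Sig.stub_nearMinPhaseInt → Summit.AtomisticToContinuum.BoseEinsteinCondensation.Cruxes.GDTransfer.Seeded.Sig.stub_localConstancyInt → Summit.AtomisticToContinuum.BoseEinsteinCondensation.Cruxes.GDTransfer.Seeded.Sig.stub_hardCoreRest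 → Summit.AtomisticToContinuum.BoseEinsteinCondensation.Theses.BECThomsonPrinciple.GDTransfer := by
  intro hSeed hBand hPair hDil hPhase hLoc hRest
  rw [gdTransfer_iff]
  intro hG v hv
  have hsoft : ∀ w : ℝ → ℝ≥0∞, IsRepulsiveFiniteRange w → IsSqIntegrableProfile w → PeriodicBECFor w :=
    fun w hw hi => stub_ivtGlue stub_countLaw hSeed w hw (hBand hG w hw hi) (stub_freeCorner w hw)
      (hLoc hPhase hPair hDil stub_countLaw w hw hi)
  by_cases hess : IsEssSqIntegrableProfile v
  · obtain ⟨w, hw, hwi, hae⟩ := hess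
    exact stub_roughNull v w hv hw hae (hsoft w hw hwi)
  · exact hRest hG hSeed hsoft v hv hess

/-! ## §4 Sanity (sorry-free) -/

/-- The rest stub is a weakening of the crux (implied by it). -/
theorem hardCoreRest_of_gdTransfer (h : GDTransfer) : Sig.stub_hardCoreRest :=
  fun hG _ _ v hv _ => (gdTransfer_iff.mp h) hG v hv

/-- Bounded finite-range measurable profiles are integrable (so skeleton v7's soft class contains v6's): the lift is
`≤ B` on `ℝ³` and vanishes off the closed ball of radius `max R₀ 0`, so `∫ (v‖x‖)^{3/2} ≤ B^{3/2}·vol(ball) < ∞`. -/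
theorem isSqIntegrableProfile_of_isBoundedProfile {v : ℝ → ℝ≥0∞} (hv : IsRepulsiveFiniteRange v)
    (hb : IsBoundedProfile v) : IsSqIntegrableProfile v := by
  obtain ⟨B, hB⟩ := hb
  obtain ⟨hmeas, R₀, hR₀⟩ := hv
  refine ⟨fun r hr h => absurd (hB r hr) (by rw [h]; exact not_le.2 ENNReal.ofReal_lt_top), ?_⟩
  -- the lift is dominated by the constant `(ofReal B)²` on the closed ball of radius `max R₀ 0`, zero outside
  set R : ℝ := max R₀ 0 with hR
  have hdom : ∀ x : Space, v ‖x‖ ^ 2 ≤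
      (Metric.closedBall (0 : Space) R).indicator (fun _ => ENNReal.ofReal B ^ 2) x := by
    intro x
    by_cases hx : x ∈ Metric.closedBall (0 : Space) R
    · rw [Set.indicator_of_mem hx]
      exact pow_le_pow_left' (hB _ (norm_nonneg x)) 2
    · rw [Set.indicator_of_notMem hx]
      have hxR : R < ‖x‖ := by simpa [Metric.mem_closedBall, dist_zero_right] using hx
      rw [hR₀ _ ((le_max_left R₀ 0).trans_lt hxR), zero_pow two_ne_zero]
  refine ne_top_of_le_ne_top ?_ (lintegral_mono hdom)
  rw [lintegral_indicator measurableSet_closedBall, setLIntegral_const]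
  exact ENNReal.mul_ne_top (ENNReal.pow_ne_top ENNReal.ofReal_ne_top) (measure_closedBall_lt_top).ne

/-- Pointwise: `a^{3/2} ≤ a² + 1` in `ℝ≥0∞`. -/
theorem rpow_three_halves_le_sq_add_one (a : ℝ≥0∞) : a ^ ((3 : ℝ) / 2) ≤ a ^ 2 + 1 := by
  rcases le_total a 1 with h | h
  · exact (ENNReal.rpow_le_one h (by norm_num)).trans le_add_self
  · calc a ^ ((3 : ℝ) / 2) ≤ a ^ (2 : ℝ) := ENNReal.rpow_le_rpow_of_exponent_le h (by norm_num)
      _ = a ^ 2 := by rw [← ENNReal.rpow_natCast]; norm_num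
      _ ≤ a ^ 2 + 1 := le_self_add

/-- **Square-integrable + finite range ⇒ the lift is in `L^{3/2}(ℝ³)`** (what the transport device consumes):
`(v‖x‖)^{3/2} ≤ (v‖x‖)² + 𝟙_{ball}(x)`. -/
theorem lintegral_rpow_le_of_sq {v : ℝ → ℝ≥0∞} (hv : IsRepulsiveFiniteRange v)
    (h2 : (∫⁻ x : Space, v ‖x‖ ^ 2) ≠ ⊤) : (∫⁻ x : Space, v ‖x‖ ^ ((3 : ℝ) / 2)) ≠ ⊤ := by
  obtain ⟨hmeas, R₀, hR₀⟩ := hv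
  set R : ℝ := max R₀ 0 with hR
  have hdom : ∀ x : Space, v ‖x‖ ^ ((3 : ℝ) / 2) ≤
      v ‖x‖ ^ 2 + (Metric.closedBall (0 : Space) R).indicator (fun _ => (1 : ℝ≥0∞)) x := by
    intro x
    by_cases hx : x ∈ Metric.closedBall (0 : Space) R
    · rw [Set.indicator_of_mem hx]
      exact rpow_three_halves_le_sq_add_one _
    · rw [Set.indicator_of_notMem hx, add_zero]
      have hxR : R < ‖x‖ := by simpa [Metric.mem_closedBall, dist_zero_right] using hx
      rw [hR₀ _ ((le_max_left R₀ 0).trans_lt hxR), ENNReal.zero_rpow_of_pos (by norm_num)]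
      exact zero_le
  have hm2 : Measurable fun x : Space => v ‖x‖ ^ 2 := (hmeas.comp measurable_norm).pow_const _
  refine ne_top_of_le_ne_top ?_ (lintegral_mono hdom)
  rw [lintegral_add_left hm2, lintegral_indicator measurableSet_closedBall, setLIntegral_const, one_mul]
  exact ENNReal.add_ne_top.2 ⟨h2, (measure_closedBall_lt_top).ne⟩

/-- **Square-integrable + finite range ⇒ the lift is in `L¹(ℝ³)`** (what the integrable Ky Fan gap consumes):
`v‖x‖ ≤ (v‖x‖)² + 𝟙_{ball}(x)`. -/
theorem lintegral_le_of_sq {v : ℝ → ℝ≥0∞} (hv : IsRepulsiveFiniteRange v)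
    (h2 : (∫⁻ x : Space, v ‖x‖ ^ 2) ≠ ⊤) : (∫⁻ x : Space, v ‖x‖) ≠ ⊤ := by
  obtain ⟨hmeas, R₀, hR₀⟩ := hv
  set R : ℝ := max R₀ 0 with hR
  have hdom : ∀ x : Space, v ‖x‖ ≤
      v ‖x‖ ^ 2 + (Metric.closedBall (0 : Space) R).indicator (fun _ => (1 : ℝ≥0∞)) x := by
    intro x
    by_cases hx : x ∈ Metric.closedBall (0 : Space) R
    · rw [Set.indicator_of_mem hx]
      -- `a ≤ a² + 1` (also in tree as `Literature.Barriers.CriticalPhenomena.ENNReal.le_sq_add_one`; inlined)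
      rcases le_total (v ‖x‖) 1 with h | h
      · exact h.trans le_add_self
      · calc v ‖x‖ = v ‖x‖ ^ 1 := (pow_one _).symm
          _ ≤ v ‖x‖ ^ 2 := pow_le_pow_right₀ h one_le_two
          _ ≤ v ‖x‖ ^ 2 + 1 := le_self_add
    · rw [Set.indicator_of_notMem hx, add_zero]
      have hxR : R < ‖x‖ := by simpa [Metric.mem_closedBall, dist_zero_right] using hx
      rw [hR₀ _ ((le_max_left R₀ 0).trans_lt hxR)]
      exact zero_le
  have hm2 : Measurable fun x : Space => v ‖x‖ ^ 2 := (hmeas.comp measurable_norm).pow_const _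
  refine ne_top_of_le_ne_top ?_ (lintegral_mono hdom)
  rw [lintegral_add_left hm2, lintegral_indicator measurableSet_closedBall, setLIntegral_const, one_mul]
  exact ENNReal.add_ne_top.2 ⟨h2, (measure_closedBall_lt_top).ne⟩

/-- v7 refines v6: the v6 rest stub `stub_singularRest` follows from the v7 pair (soft conclusion on the integrable class
+ hard-core rest): an essentially unbounded profile is either essentially integrable — then `stub_roughNull` and the
integrable conclusion — or not. -/
theorem singularRest_of_integrable
    (hsoftI : GaussianDominationCan → NoBalancedCat →
      ∀ w : ℝ → ℝ≥0∞, IsRepulsiveFiniteRange w → IsSqIntegrableProfile w → PeriodicBECFor w)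
    (hRest : Sig.stub_hardCoreRest) : Sig.stub_singularRest := by
  intro hG hSeed _ v hv _
  by_cases hess : IsEssSqIntegrableProfile v
  · obtain ⟨w, hw, hwi, hae⟩ := hess
    exact stub_roughNull v w hv hw hae (hsoftI hG hSeed w hw hwi)
  · exact hRest hG hSeed (hsoftI hG hSeed) v hv hess

/-- An UNBOUNDED member of the new soft class: the truncated Coulomb-type core `r ↦ 𝟙[0 < r ≤ R]·r⁻¹` is admissible,
finite on `[0, ∞)` and its lift is in `L^{3/2}(ℝ³)` — stated here in the weaker, elementary form that it is admissible
and finite-valued with an explicitly integrable majorant left to the stub files; we record admissibility and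
finiteness, which is what distinguishes it from the hard-core rest. -/
theorem coulombCore_admissible_finite {R : ℝ} :
    IsRepulsiveFiniteRange (fun r => if 0 < r ∧ r ≤ R then ENNReal.ofReal r⁻¹ else 0) ∧
      ∀ r, 0 ≤ r → (fun r => if 0 < r ∧ r ≤ R then ENNReal.ofReal r⁻¹ else 0) r ≠ ⊤ := by
  refine ⟨⟨?_, R, fun r hr => ?_⟩, fun r _ => ?_⟩
  · exact Measurable.ite (measurableSet_Ioc : MeasurableSet (Set.Ioc (0 : ℝ) R))
      (ENNReal.measurable_ofReal.comp measurable_inv) measurable_const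
  · simp [not_le.mpr hr]
  · dsimp only
    split_ifs
    · exact ENNReal.ofReal_ne_top
    · exact ENNReal.zero_ne_top

end Summit.AtomisticToContinuum.BoseEinsteinCondensation.Cruxes.GDTransfer.Seeded

end
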